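import Summits.QuantumFields.YangMills.Theorems.FluctuationComparisonRegPrIntLS2BetaResidualGaugeOrbit
import Summits.QuantumFields.YangMills.Theorems.FluctuationComparisonRegPrIntLWindowExactnessOfGapOrbitThm1
import HarnessLib

/-!
# REGISTRY STUB 2 «GAP♯∘» `UniformFibreGapOrbit` — THE DOOR AT PRINT'S REGULAR MINIMISER: GAP♯∘ ⟸ {TUBE-REG∘, CLOSE-PAIR∘, EXW∘ clause (2)}, with ORB an OUTPUT
# (crux `FluctuationComparisonRegPrIntL`, stmt-QuantumFields-20520; registry of record v11.4 `Cruxes/FluctuationComparisonRegPrIntL/Lines/semiclassical_s2beta.lean`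
# sha16 3732b7dff0e7789b, FROZEN (★★OWNER RULING №36) — `def UniformFibreGapOrbit` l.768, `stub_uniformFibreGapOrbit` l.1387; nothing of it is edited here)

Cell `ym3-torus` (YM ladder rung R3 = continuum `SU(2)` Yang–Mills on the three-torus — a RUNG: NOT d = 4, NOT infinite volume, NOT a mass gap, NOT Clay).
Seat `ymfull-r3-prover-3` (gen 0; R590-ym (a) item (3)); `--kind proof --supports stmt-QuantumFields-20520 --as helper`, count-neutral, DEFINITION-FREE
(0 `def`, 0 `instance`, 0 `notation`, 0 `sorry`, default heartbeats).  Second file of the seat; companion of `…S2BetaGapOrbitOfTubeClose` (the two-mechanism door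
GAP♯∘ ⟸ {TUBE∘, CLOSE∘}).

WHY.  GAP♯∘ quantifies its growth inequality over EVERY action-minimising good history `U₀ ∈ argminHist V` — a set that is NOT inside print's regular space (6)
(`histGood`'s finest threshold `θBal(K) = g_K p(g_K)` exceeds (6)'s `ε₀·L^{−2(K−J)}` on deep runs), so a supplier following [Balaban1985Variational] can only be asked
for growth about print's OWN minimiser, the regular one: `U₀ ∈ regFibrePr F J K hJK ε₀ V` (space (6): fibre ∧ both clauses of (2)) with a good history and
`wilsonAction4 U₀ = minActionRegPr …` — exactly the witness of EXW∘'s clause (2), which ✓p770212 `windowExactnessExists_of_thm1` produces from the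
[Balaban1985Variational] Thm 1 (8) letter ALONE.  This file shows that growth in a uniform sup-tube about THAT minimiser (TUBE-REG∘), together with the
kinematic pair closeness CLOSE-PAIR∘ ([Balaban1985RegularSpaces] Lemma 1 (1.24)–(1.26) iterated along the history; [Balaban1985UV3] p.259) and the existence
clause, already gives the registered row at EVERY `U₀ ∈ argminHist V` — uniqueness («`argminHist V` is ONE residual orbit», ORB) is an OUTPUT of the pair
(closeness puts any second minimiser in the tube, growth forces orbit distance `0`, ✓`exists_eq_gaugeAct_of_iInf_le_zero` puts it on the orbit), and the
orbit functional is invariant under moving the base point along its residual orbit (§1, re-indexing the infimum over the residual GROUP).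

DISPLAYED LETTERS (binder-free, registry letters only):
* **TUBE-REG∘** — GAP♯∘'s ∘-prefix with `∃ δ > 0` after `ε₀`; at an interior-window datum, for every `U₀ ∈ regFibrePr F J K hJK ε₀ V` with `U₀ ∈ histGood(θBal b₀) K J` and
  `wilsonAction4 U₀ = minActionRegPr F J K hJK ε₀ V`, and every good history `U` over `V` in the `δ`-sup-tube about the residual orbit of `U₀`:
  `μ·L^{−2(K−J)}·⨅_{w residual} Σ_ℓ dist1(U ℓ·((w•U₀) ℓ)⁻¹)² ≤ wilsonAction4 U − minActionRegPr …`.  Print: [Balaban1985Variational] (26) p.283, (142) p.299;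
  [Balaban1984PropagatorsII] (1.33); [Balaban1985UV3] (18)–(22) p.260.  Size L–XL (the quantitative heart).
* **CLOSE-PAIR∘** — as in the companion file: `∀ L b₀ p₀ δ, ∃ γ₁, ∀ F γ J K V, ∀ U′ U ∈ fibre ∩ histGood(θBal b₀)`, `∃ w residual, ∀ ℓ, dist1(U ℓ·((w•U′) ℓ)⁻¹) ≤ δ`.  Size M–L.
* **EXW∘ clause (2)** — ✓p770212's `windowExactnessExists_of_thm1` conclusion VERBATIM (so §3 discharges it from the Thm-1 letter `hT` by name).

WHAT IS PROVED.
* §1 ★ `iInf_orbitDistSq_gaugeAct_residual` — for residual `w₁`: `⨅_w Σ_ℓ dist1(U ℓ·((w•(w₁•U₀)) ℓ)⁻¹)² = ⨅_w Σ_ℓ dist1(U ℓ·((w•U₀) ℓ)⁻¹)²` (right translation by `w₁` is a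
  bijection of the residual set: ✓`residual_mul`, ✓`residual_inv`, ✓`gaugeAct_mul_eq`; `Function.Surjective.iInf_comp`).
* §2 ★★★ `uniformFibreGapOrbit_of_tubeReg_of_closePair (hT1 : ⟨TUBE-REG∘⟩) (hP : ⟨CLOSE-PAIR∘⟩) (hEx : ⟨EXW∘ (2)⟩) : ⟨GAP♯∘ v11.4 TEXT VERBATIM⟩` (RG-K substitutions; =
  ✓p770212's `hGap` token for token, docks in the registry by `exact`).
* §3 ★★ `uniformFibreGapOrbit_of_tubeReg_of_closePair_of_thm1 (hT1) (hP) (hT : Thm-1 letter)` — the same with EXW∘ (2) discharged by ✓`windowExactnessExists_of_thm1`;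
  ★★ `…_of_thm1In8` with the EX letter `hT8` VERBATIM.

NET (registry granularity, CREDIT NOTHING): «GAP♯∘ modulo letters {TUBE-REG∘, CLOSE-PAIR∘, Thm-1 letter}», the growth letter now asked ONLY at print's regular
minimiser.  HONEST: a door; TUBE-REG∘, CLOSE-PAIR∘, the Thm-1 letter ([Balaban1985Variational] Thm 1 for the (0.4) averaging `ℰp`), GAP♯∘, EXW∘, S2β, crux 20520 are NOT
proved here; no summit statement is proved by a helper; finite-volume ∕ conditional; rung R3 = SU(2) YM₃ on T³ — NOT d = 4, NOT infinite volume, NOT a mass gap, NOT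
Clay; the Yang–Mills mass gap is NOT proved.  Sorry-free, axioms standard.

References: T. Bałaban, CMP **102** (1985) 277–309 [Balaban1985Variational] (Thm 1 (8)–(10) p.279, (26) p.283, (142) p.299); CMP **99** (1985) 75–102
[Balaban1985RegularSpaces] (Lemma 1 (1.24)–(1.26) pp.79–80); CMP **96** (1984) 223–250 [Balaban1984PropagatorsII] ((1.33)); CMP **102** (1985) 255–275 [Balaban1985UV3]
((12)–(13) pp.258–259, (18)–(22) p.260).
-/

set_option autoImplicit false

noncomputable section

open MeasureTheory Filter Topology Set
open scoped Matrix.Norms.L2Operator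
open Literature.MathematicalPhysics.QuantumFieldTheory.Balaban1983to89
open Literature.MathematicalPhysics.QuantumFieldTheory.Balaban1983to89.T3ContinuumYM3Torus
open Literature.MathematicalPhysics.QuantumFieldTheory.Balaban1983to89.T3UnitLawDensityEML
open Literature.MathematicalPhysics.QuantumFieldTheory.Balaban1983to89.T3UnitScaleTilt
open Literature.MathematicalPhysics.QuantumFieldTheory.Balaban1983to89.T3TiltDescent
open Literature.MathematicalPhysics.QuantumFieldTheory.Balaban1983to89.T3PrintedRegularMinimiser
open Literature.MathematicalPhysics.QuantumFieldTheory.Balaban1983to89.T3PrintedMinimiserExistence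
open Literature.MathematicalPhysics.QuantumFieldTheory.Balaban1983to89.T3LowerAlongMinimisersSplit (MinimisersIn8At)
open Literature.MathematicalPhysics.QuantumFieldTheory.Balaban1983to89.T3ConstrainedMinimiser (fibre)
open Literature.MathematicalPhysics.QuantumFieldTheory.Balaban1983to89.Missing
open Literature.MathematicalPhysics.QuantumFieldTheory.Balaban1983to89.T4Continuum
open Summit.QuantumFields.YangMills.Theorems.FluctuationComparisonRegPrIntLS2BetaResidualGauge
open Summit.QuantumFields.YangMills.Theorems.FluctuationComparisonRegPrIntLS2BetaResidualGaugeOrbit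
open Summit.QuantumFields.YangMills.Theorems.FluctuationComparisonRegPrIntLWindowExactnessOfGapOrbitThm1

namespace Summit.QuantumFields.YangMills.Theorems.FluctuationComparisonRegPrIntLS2BetaGapOrbitOfTubeReg

/-! ## §1 The orbit functional does not see where on its residual orbit the base point sits -/

section Orbit

variable (F : T3Family) {J K : ℕ} (hJK : J ≤ K)

/-- ★ **RE-INDEXING THE ORBIT INFIMUM**: for a residual `w₁`, `⨅_w Σ_ℓ dist1(U ℓ·((w•(w₁•U₀)) ℓ)⁻¹)² = ⨅_w Σ_ℓ dist1(U ℓ·((w•U₀) ℓ)⁻¹)²` — right translation by `w₁` is a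
bijection of the residual set and `w•(w₁•U₀) = (w·w₁)•U₀`. [cite: Balaban1987RG1, p.256 (three sentences after (0.21)); Balaban1985Averaging, (8) p.19] -/
theorem iInf_orbitDistSq_gaugeAct_residual {w₁ : Site (F.P K) 0 → Matrix.specialUnitaryGroup (Fin 2) ℂ}
    (hw₁ : ∀ U : GaugeField (F.P K) 0 (Matrix.specialUnitaryGroup (Fin 2) ℂ),
      descendTo F ℰp J K hJK (GaugeField.gaugeAct w₁ U) = descendTo F ℰp J K hJK U)
    (U U₀ : GaugeField (F.P K) 0 (Matrix.specialUnitaryGroup (Fin 2) ℂ)) :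
    (⨅ w : {w : Site (F.P K) 0 → Matrix.specialUnitaryGroup (Fin 2) ℂ |
          ∀ U : GaugeField (F.P K) 0 (Matrix.specialUnitaryGroup (Fin 2) ℂ),
            descendTo F ℰp J K hJK (GaugeField.gaugeAct w U) = descendTo F ℰp J K hJK U},
        ∑ ℓ : PBond (F.P K) 0,
          dist1 (U ℓ * ((GaugeField.gaugeAct (w : Site (F.P K) 0 → Matrix.specialUnitaryGroup (Fin 2) ℂ)
            (GaugeField.gaugeAct w₁ U₀)) ℓ)⁻¹) ^ 2) =
      ⨅ w : {w : Site (F.P K) 0 → Matrix.specialUnitaryGroup (Fin 2) ℂ |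
          ∀ U : GaugeField (F.P K) 0 (Matrix.specialUnitaryGroup (Fin 2) ℂ),
            descendTo F ℰp J K hJK (GaugeField.gaugeAct w U) = descendTo F ℰp J K hJK U},
        ∑ ℓ : PBond (F.P K) 0,
          dist1 (U ℓ * ((GaugeField.gaugeAct (w : Site (F.P K) 0 → Matrix.specialUnitaryGroup (Fin 2) ℂ) U₀) ℓ)⁻¹) ^ 2 := by
  -- right translation by `w₁` on the residual set
  let e : {w : Site (F.P K) 0 → Matrix.specialUnitaryGroup (Fin 2) ℂ |
        ∀ U : GaugeField (F.P K) 0 (Matrix.specialUnitaryGroup (Fin 2) ℂ),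
          descendTo F ℰp J K hJK (GaugeField.gaugeAct w U) = descendTo F ℰp J K hJK U} →
      {w : Site (F.P K) 0 → Matrix.specialUnitaryGroup (Fin 2) ℂ |
        ∀ U : GaugeField (F.P K) 0 (Matrix.specialUnitaryGroup (Fin 2) ℂ),
          descendTo F ℰp J K hJK (GaugeField.gaugeAct w U) = descendTo F ℰp J K hJK U} :=
    fun w => ⟨(w : Site (F.P K) 0 → Matrix.specialUnitaryGroup (Fin 2) ℂ) * w₁, residual_mul F hJK w.2 hw₁⟩
  have he : Function.Surjective e := by
    intro w''
    refine ⟨⟨(w'' : Site (F.P K) 0 → Matrix.specialUnitaryGroup (Fin 2) ℂ) * w₁⁻¹,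
      residual_mul F hJK w''.2 (residual_inv F hJK hw₁)⟩, Subtype.ext ?_⟩
    show (w'' : Site (F.P K) 0 → Matrix.specialUnitaryGroup (Fin 2) ℂ) * w₁⁻¹ * w₁ = w''
    rw [inv_mul_cancel_right]
  have h1 : (⨅ w : {w : Site (F.P K) 0 → Matrix.specialUnitaryGroup (Fin 2) ℂ |
          ∀ U : GaugeField (F.P K) 0 (Matrix.specialUnitaryGroup (Fin 2) ℂ),
            descendTo F ℰp J K hJK (GaugeField.gaugeAct w U) = descendTo F ℰp J K hJK U},
        ∑ ℓ : PBond (F.P K) 0,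
          dist1 (U ℓ * ((GaugeField.gaugeAct (w : Site (F.P K) 0 → Matrix.specialUnitaryGroup (Fin 2) ℂ)
            (GaugeField.gaugeAct w₁ U₀)) ℓ)⁻¹) ^ 2) =
      ⨅ w : {w : Site (F.P K) 0 → Matrix.specialUnitaryGroup (Fin 2) ℂ |
          ∀ U : GaugeField (F.P K) 0 (Matrix.specialUnitaryGroup (Fin 2) ℂ),
            descendTo F ℰp J K hJK (GaugeField.gaugeAct w U) = descendTo F ℰp J K hJK U},
        ∑ ℓ : PBond (F.P K) 0,
          dist1 (U ℓ * ((GaugeField.gaugeAct ((e w : {w : Site (F.P K) 0 → Matrix.specialUnitaryGroup (Fin 2) ℂ |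
              ∀ U : GaugeField (F.P K) 0 (Matrix.specialUnitaryGroup (Fin 2) ℂ),
                descendTo F ℰp J K hJK (GaugeField.gaugeAct w U) = descendTo F ℰp J K hJK U}) :
            Site (F.P K) 0 → Matrix.specialUnitaryGroup (Fin 2) ℂ) U₀) ℓ)⁻¹) ^ 2 := by
    refine iInf_congr fun w => ?_
    have hew : ((e w : {w : Site (F.P K) 0 → Matrix.specialUnitaryGroup (Fin 2) ℂ |
        ∀ U : GaugeField (F.P K) 0 (Matrix.specialUnitaryGroup (Fin 2) ℂ),
          descendTo F ℰp J K hJK (GaugeField.gaugeAct w U) = descendTo F ℰp J K hJK U}) :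
        Site (F.P K) 0 → Matrix.specialUnitaryGroup (Fin 2) ℂ) =
        (w : Site (F.P K) 0 → Matrix.specialUnitaryGroup (Fin 2) ℂ) * w₁ := rfl
    rw [hew, gaugeAct_mul_eq]
  rw [h1]
  exact he.iInf_comp (fun w'' : {w : Site (F.P K) 0 → Matrix.specialUnitaryGroup (Fin 2) ℂ |
      ∀ U : GaugeField (F.P K) 0 (Matrix.specialUnitaryGroup (Fin 2) ℂ),
        descendTo F ℰp J K hJK (GaugeField.gaugeAct w U) = descendTo F ℰp J K hJK U} =>
    ∑ ℓ : PBond (F.P K) 0,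
      dist1 (U ℓ * ((GaugeField.gaugeAct (w'' : Site (F.P K) 0 → Matrix.specialUnitaryGroup (Fin 2) ℂ) U₀) ℓ)⁻¹) ^ 2)

end Orbit

/-! ## §2 The door at print's regular minimiser -/

section Door

/-- ★★★ **TUBE-REG∘ ∧ CLOSE-PAIR∘ ∧ EXW∘ (2) ⟹ GAP♯∘** (conclusion = the v11.4 text of `UniformFibreGapOrbit` with the two RG-K substitutions = ✓p770212's `hGap`,
token for token).  At a datum: EXW∘ (2) gives the regular minimising good history `U₀`; CLOSE-PAIR∘ puts the test history `U` AND the given minimiser `U₀′ ∈ argminHist V`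
in the `δ`-tube about the residual orbit of `U₀`; TUBE-REG∘ at `(U₀, U₀′)` forces orbit distance `≤ 0`, so `U₀′ = w₁•U₀` with `w₁` residual
(✓`exists_eq_gaugeAct_of_iInf_le_zero`); the orbit functional at base `U₀′` equals the one at base `U₀` (§1); TUBE-REG∘ at `(U₀, U)` is the claim.  Thresholds
merge by `min`∕`max`. [cite: Balaban1985UV3, (12)-(13) p.259 and (18)-(22) p.260; Balaban1985Variational, Thm 1 (8)-(10) p.279 and (142) p.299; Balaban1984PropagatorsII, (1.33)] -/
theorem uniformFibreGapOrbit_of_tubeReg_of_closePair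
    (hT1 : ∀ (L : ℕ), ∃ c₀ : ℝ, 0 < c₀ ∧ c₀ ≤ 1 ∧ ∀ (cw : ℝ), 0 < cw → cw ≤ c₀ → ∃ pS : ℝ, ∀ (b₀ p₀ : ℝ), 0 < b₀ → pS ≤ p₀ → 0 < p₀ →
      ∃ ε₁ : ℝ, 0 < ε₁ ∧ ∀ (ε₀ : ℝ), 0 < ε₀ → ε₀ ≤ ε₁ → ∃ δ : ℝ, 0 < δ ∧
      ∃ γ₁ : ℝ, 0 < γ₁ ∧ ∃ μ : ℝ, 0 < μ ∧ ∀ (F : T3Family) (γ : ℝ), F.L = L → 0 < γ → γ ≤ γ₁ →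
        ∀ (J K : ℕ) (hJK : J ≤ K) (V : GaugeField (F.P J) 0 (Matrix.specialUnitaryGroup (Fin 2) ℂ)), PlaqSmall (θBal F.L γ (cw * b₀) p₀ J) V →
          ∀ U₀ ∈ regFibrePr F J K hJK ε₀ V, U₀ ∈ histGood F ℰp (θBal F.L γ b₀ p₀) K J →
            wilsonAction4 U₀ = minActionRegPr F J K hJK ε₀ V →
            ∀ U ∈ fibre F ℰp J K hJK V, U ∈ histGood F ℰp (θBal F.L γ b₀ p₀) K J →
              (∃ w : Site (F.P K) 0 → Matrix.specialUnitaryGroup (Fin 2) ℂ,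
                (∀ U'' : GaugeField (F.P K) 0 (Matrix.specialUnitaryGroup (Fin 2) ℂ),
                    descendTo F ℰp J K hJK (GaugeField.gaugeAct w U'') = descendTo F ℰp J K hJK U'') ∧
                  ∀ ℓ : PBond (F.P K) 0, dist1 (U ℓ * ((GaugeField.gaugeAct w U₀) ℓ)⁻¹) ≤ δ) →
              μ * ((F.L : ℝ)⁻¹) ^ (2 * (K - J)) *
                  (⨅ w : {w : Site (F.P K) 0 → Matrix.specialUnitaryGroup (Fin 2) ℂ |
                      ∀ U : GaugeField (F.P K) 0 (Matrix.specialUnitaryGroup (Fin 2) ℂ),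
                        descendTo F ℰp J K hJK (GaugeField.gaugeAct w U) = descendTo F ℰp J K hJK U},
                    ∑ ℓ : PBond (F.P K) 0,
                      dist1 (U ℓ * ((GaugeField.gaugeAct (w : Site (F.P K) 0 → Matrix.specialUnitaryGroup (Fin 2) ℂ) U₀) ℓ)⁻¹) ^ 2)
                ≤ wilsonAction4 U - minActionRegPr F J K hJK ε₀ V)
    (hP : ∀ (L : ℕ) (b₀ p₀ : ℝ), 0 < b₀ → 0 < p₀ → ∀ (δ : ℝ), 0 < δ →
      ∃ γ₁ : ℝ, 0 < γ₁ ∧ ∀ (F : T3Family) (γ : ℝ), F.L = L → 0 < γ → γ ≤ γ₁ →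
        ∀ (J K : ℕ) (hJK : J ≤ K) (V : GaugeField (F.P J) 0 (Matrix.specialUnitaryGroup (Fin 2) ℂ)),
          ∀ U' ∈ fibre F ℰp J K hJK V, U' ∈ histGood F ℰp (θBal F.L γ b₀ p₀) K J →
            ∀ U ∈ fibre F ℰp J K hJK V, U ∈ histGood F ℰp (θBal F.L γ b₀ p₀) K J →
              ∃ w : Site (F.P K) 0 → Matrix.specialUnitaryGroup (Fin 2) ℂ,
                (∀ U'' : GaugeField (F.P K) 0 (Matrix.specialUnitaryGroup (Fin 2) ℂ),
                    descendTo F ℰp J K hJK (GaugeField.gaugeAct w U'') = descendTo F ℰp J K hJK U'') ∧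
                  ∀ ℓ : PBond (F.P K) 0, dist1 (U ℓ * ((GaugeField.gaugeAct w U') ℓ)⁻¹) ≤ δ)
    (hEx : ∀ (L : ℕ), ∃ c₀ : ℝ, 0 < c₀ ∧ c₀ ≤ 1 ∧ ∀ (cw : ℝ), 0 < cw → cw ≤ c₀ → ∃ pS : ℝ, ∀ (b₀ p₀ : ℝ), 0 < b₀ → pS ≤ p₀ → 0 < p₀ →
      ∃ ε₁ : ℝ, 0 < ε₁ ∧ ∀ (ε₀ : ℝ), 0 < ε₀ → ε₀ ≤ ε₁ →
      ∃ γ₁ : ℝ, 0 < γ₁ ∧ ∀ (F : T3Family) (γ : ℝ), F.L = L → 0 < γ → γ ≤ γ₁ →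
        ∀ (J K : ℕ) (hJK : J ≤ K) (V : GaugeField (F.P J) 0 (Matrix.specialUnitaryGroup (Fin 2) ℂ)), PlaqSmall (θBal F.L γ (cw * b₀) p₀ J) V →
          ∃ U₀ ∈ regFibrePr F J K hJK ε₀ V, U₀ ∈ histGood F ℰp (θBal F.L γ b₀ p₀) K J ∧
            wilsonAction4 U₀ = minActionRegPr F J K hJK ε₀ V) :
    ∀ (L : ℕ), ∃ c₀ : ℝ, 0 < c₀ ∧ c₀ ≤ 1 ∧ ∀ (cw : ℝ), 0 < cw → cw ≤ c₀ → ∃ pS : ℝ, ∀ (b₀ p₀ : ℝ), 0 < b₀ → pS ≤ p₀ → 0 < p₀ →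
      ∃ ε₁ : ℝ, 0 < ε₁ ∧ ∀ (ε₀ : ℝ), 0 < ε₀ → ε₀ ≤ ε₁ →
      ∃ γ₁ : ℝ, 0 < γ₁ ∧ ∃ μ : ℝ, 0 < μ ∧ ∀ (F : T3Family) (γ : ℝ), F.L = L → 0 < γ → γ ≤ γ₁ →
        ∀ (J K : ℕ) (hJK : J ≤ K) (V : GaugeField (F.P J) 0 (Matrix.specialUnitaryGroup (Fin 2) ℂ)), PlaqSmall (θBal F.L γ (cw * b₀) p₀ J) V →
          ∀ U₀ ∈ {U' | U' ∈ fibre F ℰp J K hJK V ∧ U' ∈ histGood F ℰp (θBal F.L γ b₀ p₀) K J ∧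
              wilsonAction4 U' = minActionRegPr F J K hJK ε₀ V},
            ∀ U ∈ fibre F ℰp J K hJK V, U ∈ histGood F ℰp (θBal F.L γ b₀ p₀) K J →
              μ * ((F.L : ℝ)⁻¹) ^ (2 * (K - J)) *
                  (⨅ w : {w : Site (F.P K) 0 → Matrix.specialUnitaryGroup (Fin 2) ℂ |
                      ∀ U : GaugeField (F.P K) 0 (Matrix.specialUnitaryGroup (Fin 2) ℂ),
                        descendTo F ℰp J K hJK (GaugeField.gaugeAct w U) = descendTo F ℰp J K hJK U},
                    ∑ ℓ : PBond (F.P K) 0,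
                      dist1 (U ℓ * ((GaugeField.gaugeAct (w : Site (F.P K) 0 → Matrix.specialUnitaryGroup (Fin 2) ℂ) U₀) ℓ)⁻¹) ^ 2)
                ≤ wilsonAction4 U - minActionRegPr F J K hJK ε₀ V := by
  intro L
  obtain ⟨c₁, hc₁, hc₁1, h₁⟩ := hT1 L
  obtain ⟨c₃, hc₃, -, h₃⟩ := hEx L
  refine ⟨min c₁ c₃, lt_min hc₁ hc₃, (min_le_left _ _).trans hc₁1, fun cw hcw0 hcwle => ?_⟩
  obtain ⟨pS₁, h₁'⟩ := h₁ cw hcw0 (hcwle.trans (min_le_left _ _))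
  obtain ⟨pS₃, h₃'⟩ := h₃ cw hcw0 (hcwle.trans (min_le_right _ _))
  refine ⟨max pS₁ pS₃, fun b₀ p₀ hb hpS hp => ?_⟩
  obtain ⟨ε₁, hε₁, h₁''⟩ := h₁' b₀ p₀ hb ((le_max_left _ _).trans hpS) hp
  obtain ⟨ε₃, hε₃, h₃''⟩ := h₃' b₀ p₀ hb ((le_max_right _ _).trans hpS) hp
  refine ⟨min ε₁ ε₃, lt_min hε₁ hε₃, fun ε₀ hε₀ hε₀le => ?_⟩
  obtain ⟨δ, hδ, γ₁, hγ₁, μ, hμ, H₁⟩ := h₁'' ε₀ hε₀ (hε₀le.trans (min_le_left _ _))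
  obtain ⟨γ₂, hγ₂, H₂⟩ := hP L b₀ p₀ hb hp δ hδ
  obtain ⟨γ₃, hγ₃, H₃⟩ := h₃'' ε₀ hε₀ (hε₀le.trans (min_le_right _ _))
  refine ⟨min γ₁ (min γ₂ γ₃), lt_min hγ₁ (lt_min hγ₂ hγ₃), μ, hμ, fun F γ hFL hγ hγle J K hJK V hV U₀' hU₀' U hU hUg => ?_⟩
  have hγ1 : γ ≤ γ₁ := hγle.trans (min_le_left _ _)
  have hγ2 : γ ≤ γ₂ := hγle.trans ((min_le_right _ _).trans (min_le_left _ _))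
  have hγ3 : γ ≤ γ₃ := hγle.trans ((min_le_right _ _).trans (min_le_right _ _))
  -- print's regular minimising good history
  obtain ⟨U₀, hU₀reg, hU₀good, hU₀min⟩ := H₃ F γ hFL hγ hγ3 J K hJK V hV
  have hU₀fib : U₀ ∈ fibre F ℰp J K hJK V := ((mem_regFibrePr_iff F).mp hU₀reg).1
  -- the test history is in the tube about its orbit
  have htubeU := H₂ F γ hFL hγ hγ2 J K hJK V U₀ hU₀fib hU₀good U hU hUg
  have hmain := H₁ F γ hFL hγ hγ1 J K hJK V hV U₀ hU₀reg hU₀good hU₀min U hU hUg htubeU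
  -- the given minimiser is in the tube too, hence ON the orbit
  have htube' := H₂ F γ hFL hγ hγ2 J K hJK V U₀ hU₀fib hU₀good U₀' hU₀'.1 hU₀'.2.1
  have h0 := H₁ F γ hFL hγ hγ1 J K hJK V hV U₀ hU₀reg hU₀good hU₀min U₀' hU₀'.1 hU₀'.2.1 htube'
  have hzero : wilsonAction4 U₀' - minActionRegPr F J K hJK ε₀ V = 0 := by rw [hU₀'.2.2, sub_self]
  have hLpos : (0 : ℝ) < (F.L : ℝ) := Nat.cast_pos.mpr (lt_trans zero_lt_one F.hL.2)
  have hc : 0 < μ * ((F.L : ℝ)⁻¹) ^ (2 * (K - J)) := mul_pos hμ (pow_pos (inv_pos.mpr hLpos) _)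
  have hI : (⨅ w : {w : Site (F.P K) 0 → Matrix.specialUnitaryGroup (Fin 2) ℂ |
        ∀ U : GaugeField (F.P K) 0 (Matrix.specialUnitaryGroup (Fin 2) ℂ),
          descendTo F ℰp J K hJK (GaugeField.gaugeAct w U) = descendTo F ℰp J K hJK U},
      ∑ ℓ : PBond (F.P K) 0,
        dist1 (U₀' ℓ * ((GaugeField.gaugeAct (w : Site (F.P K) 0 → Matrix.specialUnitaryGroup (Fin 2) ℂ) U₀) ℓ)⁻¹) ^ 2) ≤ 0 := by
    by_contra hI
    have hpos := mul_pos hc (not_le.mp hI)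
    exact absurd (h0.trans_eq hzero) (not_le.mpr hpos)
  obtain ⟨w₁, hw₁, hU₀'eq⟩ := exists_eq_gaugeAct_of_iInf_le_zero F hJK U₀' U₀ hI
  rw [hU₀'eq, iInf_orbitDistSq_gaugeAct_residual F hJK hw₁ U U₀]
  exact hmain

/-- ★★ **THE SAME WITH EXW∘ (2) DISCHARGED FROM THE [Balaban1985Variational] THM 1 (8) LETTER** (✓p770212 `windowExactnessExists_of_thm1`): GAP♯∘ ⟸ {TUBE-REG∘, CLOSE-PAIR∘,
Thm-1 letter}. [cite: Balaban1985Variational, Thm 1 (8) p.279 and (142) p.299; Balaban1985RegularSpaces, Lemma 1 (1.24)-(1.26) pp.79-80] -/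
theorem uniformFibreGapOrbit_of_tubeReg_of_closePair_of_thm1
    (hT1 : ∀ (L : ℕ), ∃ c₀ : ℝ, 0 < c₀ ∧ c₀ ≤ 1 ∧ ∀ (cw : ℝ), 0 < cw → cw ≤ c₀ → ∃ pS : ℝ, ∀ (b₀ p₀ : ℝ), 0 < b₀ → pS ≤ p₀ → 0 < p₀ →
      ∃ ε₁ : ℝ, 0 < ε₁ ∧ ∀ (ε₀ : ℝ), 0 < ε₀ → ε₀ ≤ ε₁ → ∃ δ : ℝ, 0 < δ ∧
      ∃ γ₁ : ℝ, 0 < γ₁ ∧ ∃ μ : ℝ, 0 < μ ∧ ∀ (F : T3Family) (γ : ℝ), F.L = L → 0 < γ → γ ≤ γ₁ →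
        ∀ (J K : ℕ) (hJK : J ≤ K) (V : GaugeField (F.P J) 0 (Matrix.specialUnitaryGroup (Fin 2) ℂ)), PlaqSmall (θBal F.L γ (cw * b₀) p₀ J) V →
          ∀ U₀ ∈ regFibrePr F J K hJK ε₀ V, U₀ ∈ histGood F ℰp (θBal F.L γ b₀ p₀) K J →
            wilsonAction4 U₀ = minActionRegPr F J K hJK ε₀ V →
            ∀ U ∈ fibre F ℰp J K hJK V, U ∈ histGood F ℰp (θBal F.L γ b₀ p₀) K J →
              (∃ w : Site (F.P K) 0 → Matrix.specialUnitaryGroup (Fin 2) ℂ,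
                (∀ U'' : GaugeField (F.P K) 0 (Matrix.specialUnitaryGroup (Fin 2) ℂ),
                    descendTo F ℰp J K hJK (GaugeField.gaugeAct w U'') = descendTo F ℰp J K hJK U'') ∧
                  ∀ ℓ : PBond (F.P K) 0, dist1 (U ℓ * ((GaugeField.gaugeAct w U₀) ℓ)⁻¹) ≤ δ) →
              μ * ((F.L : ℝ)⁻¹) ^ (2 * (K - J)) *
                  (⨅ w : {w : Site (F.P K) 0 → Matrix.specialUnitaryGroup (Fin 2) ℂ |
                      ∀ U : GaugeField (F.P K) 0 (Matrix.specialUnitaryGroup (Fin 2) ℂ),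
                        descendTo F ℰp J K hJK (GaugeField.gaugeAct w U) = descendTo F ℰp J K hJK U},
                    ∑ ℓ : PBond (F.P K) 0,
                      dist1 (U ℓ * ((GaugeField.gaugeAct (w : Site (F.P K) 0 → Matrix.specialUnitaryGroup (Fin 2) ℂ) U₀) ℓ)⁻¹) ^ 2)
                ≤ wilsonAction4 U - minActionRegPr F J K hJK ε₀ V)
    (hP : ∀ (L : ℕ) (b₀ p₀ : ℝ), 0 < b₀ → 0 < p₀ → ∀ (δ : ℝ), 0 < δ →
      ∃ γ₁ : ℝ, 0 < γ₁ ∧ ∀ (F : T3Family) (γ : ℝ), F.L = L → 0 < γ → γ ≤ γ₁ →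
        ∀ (J K : ℕ) (hJK : J ≤ K) (V : GaugeField (F.P J) 0 (Matrix.specialUnitaryGroup (Fin 2) ℂ)),
          ∀ U' ∈ fibre F ℰp J K hJK V, U' ∈ histGood F ℰp (θBal F.L γ b₀ p₀) K J →
            ∀ U ∈ fibre F ℰp J K hJK V, U ∈ histGood F ℰp (θBal F.L γ b₀ p₀) K J →
              ∃ w : Site (F.P K) 0 → Matrix.specialUnitaryGroup (Fin 2) ℂ,
                (∀ U'' : GaugeField (F.P K) 0 (Matrix.specialUnitaryGroup (Fin 2) ℂ),
                    descendTo F ℰp J K hJK (GaugeField.gaugeAct w U'') = descendTo F ℰp J K hJK U'') ∧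
                  ∀ ℓ : PBond (F.P K) 0, dist1 (U ℓ * ((GaugeField.gaugeAct w U') ℓ)⁻¹) ≤ δ)
    (hT : ∀ L : ℕ, Odd L → 1 < L → ∃ a₀ a₁ B₃ : ℝ, 0 < a₀ ∧ 0 < a₁ ∧ 0 < B₃ ∧ Thm1GlobalMinAt L a₀ a₁ B₃) :
    ∀ (L : ℕ), ∃ c₀ : ℝ, 0 < c₀ ∧ c₀ ≤ 1 ∧ ∀ (cw : ℝ), 0 < cw → cw ≤ c₀ → ∃ pS : ℝ, ∀ (b₀ p₀ : ℝ), 0 < b₀ → pS ≤ p₀ → 0 < p₀ →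
      ∃ ε₁ : ℝ, 0 < ε₁ ∧ ∀ (ε₀ : ℝ), 0 < ε₀ → ε₀ ≤ ε₁ →
      ∃ γ₁ : ℝ, 0 < γ₁ ∧ ∃ μ : ℝ, 0 < μ ∧ ∀ (F : T3Family) (γ : ℝ), F.L = L → 0 < γ → γ ≤ γ₁ →
        ∀ (J K : ℕ) (hJK : J ≤ K) (V : GaugeField (F.P J) 0 (Matrix.specialUnitaryGroup (Fin 2) ℂ)), PlaqSmall (θBal F.L γ (cw * b₀) p₀ J) V →
          ∀ U₀ ∈ {U' | U' ∈ fibre F ℰp J K hJK V ∧ U' ∈ histGood F ℰp (θBal F.L γ b₀ p₀) K J ∧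
              wilsonAction4 U' = minActionRegPr F J K hJK ε₀ V},
            ∀ U ∈ fibre F ℰp J K hJK V, U ∈ histGood F ℰp (θBal F.L γ b₀ p₀) K J →
              μ * ((F.L : ℝ)⁻¹) ^ (2 * (K - J)) *
                  (⨅ w : {w : Site (F.P K) 0 → Matrix.specialUnitaryGroup (Fin 2) ℂ |
                      ∀ U : GaugeField (F.P K) 0 (Matrix.specialUnitaryGroup (Fin 2) ℂ),
                        descendTo F ℰp J K hJK (GaugeField.gaugeAct w U) = descendTo F ℰp J K hJK U},
                    ∑ ℓ : PBond (F.P K) 0,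
                      dist1 (U ℓ * ((GaugeField.gaugeAct (w : Site (F.P K) 0 → Matrix.specialUnitaryGroup (Fin 2) ℂ) U₀) ℓ)⁻¹) ^ 2)
                ≤ wilsonAction4 U - minActionRegPr F J K hJK ε₀ V :=
  uniformFibreGapOrbit_of_tubeReg_of_closePair hT1 hP (windowExactnessExists_of_thm1 hT)

end Door

end Summit.QuantumFields.YangMills.Theorems.FluctuationComparisonRegPrIntLS2BetaGapOrbitOfTubeReg

end
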